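import Summits.CriticalPhenomena.PercolationContinuityZ3.Theorems.Transplant.FKConnectivityAllQPat3DeltaSP
import Summits.CriticalPhenomena.PercolationContinuityZ3.Theorems.Transplant.FKConnectivityAllQK4FreeReduce
import Summits.CriticalPhenomena.PercolationContinuityZ3.Theorems.Transplant.FKConnectivityAllQAntipodalLoops
import HarnessLib

/-!
# Connectivity correlation inequalities for `φ_{w,q}`, every `q > 0` — **THE HUB INEQUALITY AT EVERY TRIPLE ON EVERY SERIES–PARALLEL (`K₄`-MINOR-FREE) SUPPORT**

Proof file (`--supports stmt-CriticalPhenomena-4575`), census lineage (gen 38) of LANE 2's FK sub-programme; builds on p205010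
(kernel theorem, internal audit signed; external expert review pending).  No definitions, no named facts, no sorries.

Census g37's measure-level rows on 2-tree supports (`FK.hubUnder_of_isTwoTree_support`, `…Pat3DeltaSP.lean`: THEOREM SP on minors ⇒ the
hub inequality ALR (13)/(14) at EVERY triple for every weight vector supported in a 2-tree, every `q > 0`; and the sharper correlation
through `FK.real_conn_union_le_of_isTTSP_support` + fk-2's bridge `FK.IsTTSP.of_isTwoTree`) fed into the reductions of
`…FKConnectivityAllQK4FreeReduce.lean` (`K₄`-minor-free graphs are partial 2-trees — fk-3's `FK.exists_isTwoTree_superset_of_not_hasK4Minor`;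
loop erasure).  RESULTS, for every `q > 0`, every finite `V`, every `w : Sym2 V → [0,1]` whose SUPPORT GRAPH has no `K₄` minor and EVERY
`o a b` / `b s t : V`: **`FK.hubUnder_of_noK4Minor_support`** `φ_{w,q}(o ↔ a)·φ_{w,q}(b ↔ a) ≤ φ_{w,q}(o ↔ a ↔ b)`, its `Fin n` form
`FK.hubFK_of_noK4Minor_support` (the clause of `FK.HubFK q` on series–parallel supports), `FK.real_conn_union_le_of_isTwoTree_support` and
**`FK.real_conn_union_le_of_noK4Minor_support`** `φ(s ↔ t)·φ(b ↔ {s,t}) ≤ φ(Ω)·φ(s ↔ t, b ↔ {s,t})`.  This SUPERSEDES the tree's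
`FK.hubUnder_of_noK4Minor'` (`q < 1`, and `K₄`-minor-freeness demanded of `supp(w) ∪ {oa, ba}`): no pair is added to the support (newly
covered, e.g.: `supp(w) = K_{2,3}` with the hub `a` and both `o`, `b` on the side of size three, where adding `oa`, `ba` creates a `K₄` minor)
and every `q > 0` is allowed (for `q ≥ 1` the row is FKG).  At the polar level: **`FK.antipodalT_nonneg_of_noK4Minor`** — CONJECTURE T
(`FK.AntipodalTPos`) for every `q > 0` on every loopless `K₄`-minor-free edge set `F ∪ C` (census g37's `antipodalT_nonneg_of_isTTSP_minor` on a
two-terminal series–parallel network through every vertex containing `F ∪ C`).  Beyond series–parallel supports the hub inequality for `q < 1`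
is OPEN (Grimmett 2006 §3.9; census evidence only: `FK.SPGoodPos`, `…Pat3SPConjecture.lean`).
[cite: AyyerLinussonRavichandran2025, §7 eq. (13)–(15), Conj. 7.1 (p. 22)] [cite: Grimmett2006, §3.9 (p. 63); §1.4 eq. (1.20) (p. 15)]
[cite: Diestel2017, §7.3 (Prop. 7.3.1, Cor. 7.3.2)] [cite: Wagner2006, §5.3]
-/

noncomputable section

namespace Summit.CriticalPhenomena.PercolationContinuityZ3.Theorems

namespace FK

open MeasureTheory Set Literature.Probability.LatticeModels Literature.Probability.Percolation
open scoped Classical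

variable {V : Type*} [Fintype V] (w : Sym2 V → unitInterval)

/-- **THE HUB INEQUALITY AT EVERY TRIPLE OF VERTICES ON EVERY SERIES–PARALLEL SUPPORT, every `q > 0`** (census g38 = census g37's
`FK.hubUnder_of_isTwoTree_support` ∘ `FK.hubUnder_of_noK4Minor_of_twoTree`): if the support graph of `w` has no `K₄` minor then
`φ_{w,q}(o ↔ a)·φ_{w,q}(b ↔ a) ≤ φ_{w,q}(Ω)·φ_{w,q}(o ↔ a, b ↔ a)` for ALL `o a b : V`.  Supersedes `FK.hubUnder_of_noK4Minor'`.
[cite: AyyerLinussonRavichandran2025, §7 eq. (13)–(14), Conj. 7.1 (p. 22)] [cite: Diestel2017, §7.3 (Prop. 7.3.1, Cor. 7.3.2)]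
[cite: Grimmett2006, §3.9 (p. 63)] -/
theorem hubUnder_of_noK4Minor_support {q : ℝ} (hq : 0 < q)
    (hK : ¬ HasK4Minor (SimpleGraph.fromEdgeSet {e : Sym2 V | ((w e : unitInterval) : ℝ) ≠ 0})) (o a b : V) :
    HubUnder (rcMeasureW w q ∅) o a b :=
  hubUnder_of_noK4Minor_of_twoTree w hq (fun _ hT w' hw' => hubUnder_of_isTwoTree_support w' hq hT hw') hK o a b

/-- **`HubFK`-shaped corollary**: for every `q > 0`, every `n` and every weight vector on `Fin n` whose support graph has no `K₄` minor,
the hub inequality holds at every triple — the clause of `FK.HubFK q` on series–parallel supports, unconditionally.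
[cite: AyyerLinussonRavichandran2025, §7 eq. (13)–(14), Conj. 7.1 (p. 22)] [cite: Wagner2006, §5.3] -/
theorem hubFK_of_noK4Minor_support {q : ℝ} (hq : 0 < q) (n : ℕ) (w' : Sym2 (Fin n) → unitInterval)
    (hK : ¬ HasK4Minor (SimpleGraph.fromEdgeSet {e : Sym2 (Fin n) | ((w' e : unitInterval) : ℝ) ≠ 0})) (o a b : Fin n) :
    HubUnder (rcMeasureW w' q ∅) o a b :=
  hubUnder_of_noK4Minor_support w' hq hK o a b

/-- **The sharper correlation at EVERY triple on 2-TREE supports, every `q > 0`** (census g37's `FK.real_conn_union_le_of_isTTSP_support`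
through fk-2's bridge `FK.IsTTSP.of_isTwoTree`). [cite: AyyerLinussonRavichandran2025, §7 (p. 22)] [cite: Wagner2006, §5.3] -/
theorem real_conn_union_le_of_isTwoTree_support {q : ℝ} (hq : 0 < q) {T : Set (Sym2 V)} (hT : IsTwoTree T)
    (hw : ∀ e, ((w e : unitInterval) : ℝ) ≠ 0 → e ∈ T) (b s t : V) :
    (rcMeasureW w q ∅).real (openConn s t) * (rcMeasureW w q ∅).real (openConn b s ∪ openConn b t) ≤
      (rcMeasureW w q ∅).real univ * (rcMeasureW w q ∅).real (openConn s t ∩ (openConn b s ∪ openConn b t)) := by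
  obtain ⟨x, y, hxy⟩ : ∃ x y : V, s(x, y) ∈ T := by
    cases hT with
    | @pair u v _ => exact ⟨u, v, Set.mem_singleton _⟩
    | @cons T' u v _ _ huv _ => exact ⟨u, v, Set.mem_union_left _ huv⟩
  obtain ⟨E, hE, hExy⟩ := IsTTSP.of_isTwoTree hT hxy
  exact real_conn_union_le_of_isTTSP_support w hq hExy (fun e he => by rw [hE]; exact hw e he) b s t

/-- **THE SHARPER CORRELATION AT EVERY TRIPLE ON EVERY SERIES–PARALLEL SUPPORT, every `q > 0`**: if the support graph of `w` has no
`K₄` minor then `φ_{w,q}(s ↔ t)·φ_{w,q}(b ↔ {s,t}) ≤ φ_{w,q}(Ω)·φ_{w,q}(s ↔ t, b ↔ {s,t})` for ALL `b s t : V`.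
[cite: AyyerLinussonRavichandran2025, §7 eq. (13)–(15) (p. 22)] [cite: Diestel2017, §7.3 (Prop. 7.3.1, Cor. 7.3.2)] -/
theorem real_conn_union_le_of_noK4Minor_support {q : ℝ} (hq : 0 < q)
    (hK : ¬ HasK4Minor (SimpleGraph.fromEdgeSet {e : Sym2 V | ((w e : unitInterval) : ℝ) ≠ 0})) (b s t : V) :
    (rcMeasureW w q ∅).real (openConn s t) * (rcMeasureW w q ∅).real (openConn b s ∪ openConn b t) ≤
      (rcMeasureW w q ∅).real univ * (rcMeasureW w q ∅).real (openConn s t ∩ (openConn b s ∪ openConn b t)) :=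
  real_conn_union_le_of_noK4Minor_of_twoTree w hq (fun _ hT w' hw' => real_conn_union_le_of_isTwoTree_support w' hq hT hw') hK b s t

/-! ### CONJECTURE T on `K₄`-minor-free minors, every `q > 0` -/

/-- **CONJECTURE T for every `q > 0` on every LOOPLESS `K₄`-minor-free edge set** (the general statement is
`FK.antipodalT_nonneg_of_noK4Minor` below): if the graph with edge set `F ∪ C` has no `K₄` minor (and `F ∪ C` has no diagonal pair) then `T_q(b,s,t;F,C) ≥ 0` for all vertices `b, s, t` — census g37's
`FK.antipodalT_nonneg_of_isTTSP_minor` (THEOREM SP on minors) on a two-terminal series–parallel network containing `F ∪ C`, which exists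
because `K₄`-minor-free graphs are partial 2-trees (fk-3's `K4Free.exists_superset_of_not_hasK4Minor`, covering every vertex) and 2-trees
are TTSP networks (fk-2's `FK.IsTTSP.of_isTwoTree`); coincident marks give `T = 0` (`FK.antipodalT_eq_zero_of_not_distinct`).
[cite: AyyerLinussonRavichandran2025, §7 eq. (13)–(15), Conj. 7.1 (p. 22)] [cite: Diestel2017, §7.3 (Prop. 7.3.1, Cor. 7.3.2)] -/
theorem antipodalT_nonneg_of_noK4Minor_of_loopless {q : ℝ} (hq : 0 < q) {F C : Finset (Sym2 V)}
    (hK : ¬ HasK4Minor (SimpleGraph.fromEdgeSet (↑(F ∪ C) : Set (Sym2 V)))) (hnd : ∀ e ∈ F ∪ C, ¬ e.IsDiag) (b s t : V) :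
    0 ≤ antipodalT q b s t (↑F : BondConfig V) (↑C : BondConfig V) := by
  by_cases hdis : b = s ∨ b = t ∨ s = t
  · rw [antipodalT_eq_zero_of_not_distinct q hdis]
  have hbs : b ≠ s := fun h => hdis (Or.inl h)
  have hbt : b ≠ t := fun h => hdis (Or.inr (Or.inl h))
  have hst : s ≠ t := fun h => hdis (Or.inr (Or.inr h))
  -- a 2-tree through every vertex containing every pair of `F ∪ C`
  have hcard : (Finset.univ : Finset V).card = (Fintype.card V - 2) + 2 := by
    have h2 : 1 < Fintype.card V := Fintype.one_lt_card_iff.2 ⟨b, s, hbs⟩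
    rw [Finset.card_univ]; omega
  obtain ⟨T, hT, hedges, hcov, -, -⟩ := K4Free.exists_superset_of_not_hasK4Minor (V := V) IsTwoTree
    (fun u v huv => IsTwoTree.pair huv) (fun T u v x hT huv hx => IsTwoTree.cons hT huv hx)
    (Fintype.card V - 2) Finset.univ _ hcard hK (fun a b _ => ⟨Finset.mem_univ a, Finset.mem_univ b⟩)
  obtain ⟨x, y, hxy⟩ : ∃ x y : V, s(x, y) ∈ T := by
    cases hT with
    | @pair u v _ => exact ⟨u, v, Set.mem_singleton _⟩
    | @cons T' u v _ _ huv _ => exact ⟨u, v, Set.mem_union_left _ huv⟩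
  obtain ⟨N, hN, hNxy⟩ := IsTTSP.of_isTwoTree hT hxy
  have hsub : F ∪ C ⊆ N := by
    intro g hg
    have hgT : g ∈ T := by
      have hgnd := hnd g hg
      induction g using Sym2.ind with
      | h u v =>
        exact hedges u v ((SimpleGraph.fromEdgeSet_adj _).2 ⟨Finset.mem_coe.2 hg, fun h => hgnd (Sym2.mk_isDiag_iff.2 h)⟩)
    rw [← hN] at hgT
    exact Finset.mem_coe.1 hgT
  have hon : ∀ v : V, ∃ e ∈ N, v ∈ e := fun v => by
    obtain ⟨e, he, hve⟩ := hcov v (Finset.mem_univ v)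
    rw [← hN] at he
    exact ⟨e, Finset.mem_coe.1 he, hve⟩
  exact antipodalT_nonneg_of_isTTSP_minor hq hNxy ((Finset.subset_union_left).trans hsub)
    ((Finset.subset_union_right).trans hsub) (hon b) (hon s) (hon t) hbs hbt hst

/-- **CONJECTURE T (`FK.AntipodalTPos`) HOLDS FOR EVERY `q > 0` WHENEVER THE GRAPH OF `F ∪ C` HAS NO `K₄` MINOR**: `T_q(b,s,t;F,C) ≥ 0` for all
vertices `b, s, t` — loops are irrelevant to the sign of `T_q` (`FK.antipodalT_nonneg_of_nonneg_filter`, `…AntipodalLoops.lean`) and the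
loop-free parts form a `K₄`-minor-free graph as well (`FK.hasK4Minor_mono`).  On the series–parallel class this is the polar / square-free-
coefficient form of the hub conjecture, for every `q > 0`; beyond it the statement is OPEN (census to 10 vertices).
[cite: AyyerLinussonRavichandran2025, §7 eq. (13)–(15), Conj. 7.1 (p. 22)] [cite: Diestel2017, §7.3 (Prop. 7.3.1, Cor. 7.3.2)] -/
theorem antipodalT_nonneg_of_noK4Minor {q : ℝ} (hq : 0 < q) {F C : Finset (Sym2 V)}
    (hK : ¬ HasK4Minor (SimpleGraph.fromEdgeSet (↑(F ∪ C) : Set (Sym2 V)))) (b s t : V) :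
    0 ≤ antipodalT q b s t (↑F : BondConfig V) (↑C : BondConfig V) := by
  refine antipodalT_nonneg_of_nonneg_filter q b s t F C (antipodalT_nonneg_of_noK4Minor_of_loopless hq ?_ ?_ b s t)
  · refine fun h => hK (hasK4Minor_mono (SimpleGraph.fromEdgeSet_mono ?_) h)
    intro e he
    simp only [Finset.coe_union, Finset.coe_filter, Set.mem_union, Set.mem_setOf_eq] at he
    simp only [Finset.coe_union, Set.mem_union, Finset.mem_coe]
    rcases he with ⟨h1, _⟩ | ⟨h1, _⟩
    · exact Or.inl h1
    · exact Or.inr h1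
  · intro e he
    rcases Finset.mem_union.1 he with h | h
    · exact (Finset.mem_filter.1 h).2
    · exact (Finset.mem_filter.1 h).2

end FK

end Summit.CriticalPhenomena.PercolationContinuityZ3.Theorems

end
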